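import Summits.QuantumFields.YangMills.Theorems.UnitScaleTiltProp7GreenPiBlockLettersEdition
import Summits.QuantumFields.YangMills.Theorems.UnitScaleTiltProp7GreenPiMinusEtaBlockDecay
import Summits.QuantumFields.YangMills.Theorems.UnitScaleTiltProp7OneFormGreenBlockSupFamily
import Summits.QuantumFields.YangMills.Theorems.UnitScaleTiltProp7OneFormGreenBlockDivergenceFamily
import Summits.QuantumFields.YangMills.Theorems.UnitScaleTiltProp7GaugeProjectorBlockPackageFamily
import Summits.QuantumFields.YangMills.Theorems.UnitScaleTiltProp7GaugeProjectorBlockPackageFamilyC2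
import Summits.QuantumFields.YangMills.Theorems.UnitScaleTiltProp7Kernel133OfPiBlockLetters
import HarnessLib

/-!
# Route `UnitScaleTilt`, crux K1 «MinimiserStabilityRegPr» (stmt-QuantumFields-19200), EX row `h133` ∕ Π-slot road N6, family level:
# **THE `hGblk`(Π) ∃-PACKAGE** — N6 FILE D3 `hGblk_pi_of_blockLetters` AT EVERY MEMBER, ITS FIVE BLOCK LETTERS, TWO POSITIVITY CLASSES AND THE WINDOW DISCHARGED BY THE
# LANDED L-ONLY FAMILIES ((Gb) ✓`blockSup_GT_DeltaEtaSlot_family`, (Db) ✓`divergence_GT_DeltaEtaSlot_family`, (c1b)(c3b) ✓`hc1b_hc3b_family`, (c2b) ✓`hc2b_family`,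
# (γ) ✓`hco_DeltaEtaSlot_exists` ∕ ✓`hco_DeltaPiSlotP_exists`)

Cell `ym3-torus` (HUMAN RULING D-0037; rung R3 = SU(2) YM₃ on T³ — NOT d = 4, NOT infinite volume, NOT a mass gap, NOT Clay).  Width seat `ym3-torus-px16` g14
(`--supports stmt-QuantumFields-19200 --as helper`).  THEOREMS ONLY (0 `def`, 0 `sorry`, default heartbeats); count-neutral.

WHAT.  ★★★ `hGblk_pi_family_exists` — for positive L-only weights `c₀ cB : ℕ → ℝ` and a coupling window `0 < a₀ ≤ a₁` THERE ARE L-only `αP CP KP δP : ℕ → ℝ` (cap with the three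
windows of record, constant `≥ 0`, rate `> 0`) such that for every `L > 1`, member `i : Idx L`, background `U₀` with `RegPr ρ U₀`, `ρ ≤ αP L`, under `Lift`, with the T1 no-wrap
ROOM `2(12·L^{K−n}+5) ≤ sitesPerDir 0` (DISPLAYED — the (Db)∕(c2b) legs carry it; ★★OWNER RECORD 17ck ∕ LOCATE (CV) #47), and every coupling
`a₀(c₀ L∕cB L)ℓ³ ≤ a ≤ a₁(c₀ L∕cB L)ℓ³`: the H-DOOR's `hGblk` TEXT at the Π-slot `Δx := DeltaPiSlotP … a` —
`∀ X z, (∀ b, X b ≠ 0 → B b₋ = z) → ∀ s ≥ 0, (∀ b, ‖X b‖ ≤ s) → ∀ bd, ‖toL2⁻¹(G_π(toL2 X)) bd‖ ≤ s·CP L·e^{−δP L·tdist(B bd₋, z)}` — AND its `D*_{U₀}`-twin (D3's second conjunct).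
PROOF.  Seven `obtain`s; common rate `δ₁ L := min` of the five letters' rates (px10 ✓`blockLetter_mono_rate`), `ν L := δ L := δ₁ L∕2` (so `δ + ν ≤ δ₁`); the two `PosOnto`s by
✓`posOnto_of_coercive` over (γ); the D3 window `hwin` by the ONE pure-real choice `αP L ≤ 1∕(2W(L)+2)` (§1 `hwin_of_le_inv`: for `0 ≤ α ≤ 1` the window's left side is `≤ α·W`);
`RegPr (αP L) U₀` by ✓`regPr_mono`; then D3 ✓`hGblk_pi_of_blockLetters` at the member, `CP L := 2(BV L·V L + BD L·V L)`, `V L := (2(1+1∕ν L))³`.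
DOCKING.  px10's ✓`kernel133_family_of_kinvRow_of_greenBlockSup` ∕ PART C `hGblk`(Π) family binder with the thread `Λ L i U₀ := Lift ∧ ROOM ∧ (a L i ∈ window)` — a λ-term.
HONEST SCOPE.  An `∃`-package over landed `∃`-packages and D3's member theorem; the constants are EXISTENTIAL-but-L-only; CONDITIONAL on nothing displayed beyond `RegPr`∕cap∕`Lift`∕ROOM∕
coupling window; nothing of `hKinv`, `h133`, the EX rows, EX or the crux is proved; no summit is proved by a helper.  Credit: D3 = ★p1 g27; families = px16∕px21∕px5 lineages; (γ) = ★p1.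

References: T. Bałaban, CMP **99** (1985) 389–434 [Balaban1985BackgroundPropagators] (Thm 3.3 (3.46)–(3.49) pp.398–399, Thm 3.11 p.416, (3.118)–(3.122) pp.419–420, Thm 3.12 p.423);
CMP **102** (1985) 277–309 [Balaban1985Variational] (Thm 1 p.279, the `L`-only constants; (134)–(139) pp.298–299).
-/

set_option autoImplicit false

noncomputable section

open scoped Matrix.Norms.L2Operator BigOperators InnerProductSpace ComplexConjugate

namespace Summit.QuantumFields.YangMills.Theorems.Prop7GreenPiBlockFamilyPackage

open Literature.MathematicalPhysics.QuantumFieldTheory.Balaban1983to89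
open Literature.MathematicalPhysics.QuantumFieldTheory.Balaban1983to89.T3ContinuumYM3Torus
open Literature.MathematicalPhysics.QuantumFieldTheory.Balaban1983to89.T3PrintedRegularMinimiser (RegPr)
open Literature.MathematicalPhysics.QuantumFieldTheory.Balaban1983to89.T3PrintedMinimiserExistence (regPr_mono)
open B15DeterminingSets (embIter)
open T3SectALandauChart (bgUnits)
open B11Eq103H1Complex (BondL2K)
open B5Eq118OneStroke (iterBlockOf)
open Summit.QuantumFields.YangMills.Theorems.Prop8Chart (emlIterU)
open Summit.QuantumFields.YangMills.Theorems.Prop7SectET3Transport (periodsT3)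
open Summit.QuantumFields.YangMills.Theorems.Prop7SectET3HilbertLetters (W₂ toL2 toL2S DL2 DstarL2)
open Summit.QuantumFields.YangMills.Theorems.Prop7SectET3WilsonHessian (DeltaEtaSlot)
open Summit.QuantumFields.YangMills.Theorems.Prop7SectET3GaugeProjector (RS)
open Summit.QuantumFields.YangMills.Theorems.Prop7SectET3CurvedPropagators (laplaceA GT PosOnto)
open Summit.QuantumFields.YangMills.Theorems.Prop7SectET3DeltaPiPInv (GprimeP DeltaPiSlotP)
open Summit.QuantumFields.YangMills.Theorems.Prop7OneFormCoerciveHolds (hco_DeltaEtaSlot_exists hco_DeltaPiSlotP_exists posOnto_of_coercive)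
open Summit.QuantumFields.YangMills.Theorems.Prop7OneFormGreenBlockSupFamily (blockSup_GT_DeltaEtaSlot_family)
open Summit.QuantumFields.YangMills.Theorems.Prop7OneFormGreenBlockDivergenceFamily (divergence_GT_DeltaEtaSlot_family)
open Summit.QuantumFields.YangMills.Theorems.Prop7GaugeProjectorBlockPackageFamily (hc1b_hc3b_family)
open Summit.QuantumFields.YangMills.Theorems.Prop7GaugeProjectorBlockPackageFamilyC2 (hc2b_family)
open Summit.QuantumFields.YangMills.Theorems.Prop7Kernel133OfPiBlockLetters (blockLetter_mono_rate)
open Summit.QuantumFields.YangMills.Theorems.Prop7GreenPiBlockLettersEdition (hGblk_pi_of_blockLetters)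
open Summit.QuantumFields.YangMills.Theorems.Prop7GreenPiMinusEtaBlockDecay (hDelta_pi_of_blockLetters)

/-! ## §1 The window numerics: `hwin` from `α ≤ 1∕(2W+2)` -/

/-- ★ **THE D3 WINDOW FROM ONE SMALLNESS OF THE CAP**: for nonnegative `E A B C D` and `0 ≤ α ≤ 1`, if `α ≤ 1∕(2·E(AB + 3CD(D + EAB)) + 2)` then
`E·(αAB + 3αCD(D + EαAB)) ≤ ½` (D3's `hwin` with `E = 2(1+e^{4δ})`, `A = C₁V`, `B = BV·V + BD·V`, `C = C₃V`, `D = 1 + C₂V`, `V = (2(1+1∕ν))³`). [folklore] -/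
theorem hwin_of_le_inv {E A B C D α : ℝ} (hE : 0 ≤ E) (hA : 0 ≤ A) (hB : 0 ≤ B) (hC : 0 ≤ C) (hD : 0 ≤ D) (hα : 0 ≤ α) (hα1 : α ≤ 1)
    (hαW : α ≤ 1 / (2 * (E * (A * B + 3 * C * D * (D + E * A * B))) + 2)) :
    E * (α * A * B + 3 * α * C * D * (D + E * α * A * B)) ≤ 1 / 2 := by
  set W : ℝ := E * (A * B + 3 * C * D * (D + E * A * B)) with hW
  have hW0 : 0 ≤ W := by rw [hW]; positivity
  have hin : E * α * A * B ≤ E * A * B := by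
    have h0 : 0 ≤ E * A * B := by positivity
    calc E * α * A * B = α * (E * A * B) := by ring
      _ ≤ 1 * (E * A * B) := mul_le_mul_of_nonneg_right hα1 h0
      _ = E * A * B := one_mul _
  have h1 : E * (α * A * B + 3 * α * C * D * (D + E * α * A * B)) = α * (E * (A * B + 3 * C * D * (D + E * α * A * B))) := by ring
  have h2 : E * (A * B + 3 * C * D * (D + E * α * A * B)) ≤ W := by
    rw [hW]; gcongr
  rw [h1]
  calc α * (E * (A * B + 3 * C * D * (D + E * α * A * B))) ≤ α * W := mul_le_mul_of_nonneg_left h2 hα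
    _ ≤ (1 / (2 * W + 2)) * W := mul_le_mul_of_nonneg_right hαW hW0
    _ ≤ 1 / 2 := by
        rw [div_mul_eq_mul_div, one_mul, div_le_iff₀ (by positivity)]
        linarith

/-- ★ **THE CONE LETTER'S CONSTANT IS MONOTONE IN THE RADIUS**: D4's `hΔb` constant `α·κ′(α)` with `κ′(α) = 2(BVV+BDV)e(2C1V·BVV + 6C3V(1+C2V)(C2V + 2αe·C1V·BVV))`
satisfies `s·(α·κ′(α))·E ≤ s·(α·κ′(α₁))·E` for `0 ≤ α ≤ α₁` (all letters nonnegative). [folklore] -/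
theorem cone_const_mono {s α α₁ BVV BDV C1V C2V C3V e E : ℝ} (hs : 0 ≤ s) (hα : 0 ≤ α) (hα₁ : α ≤ α₁) (hBV : 0 ≤ BVV) (hBD : 0 ≤ BDV)
    (h1 : 0 ≤ C1V) (h2 : 0 ≤ C2V) (h3 : 0 ≤ C3V) (he : 0 ≤ e) (hE : 0 ≤ E) :
    s * (α * (2 * (BVV + BDV) * e * (2 * C1V * BVV + 6 * C3V * (1 + C2V) * (C2V + 2 * α * e * C1V * BVV)))) * E
      ≤ s * (α * (2 * (BVV + BDV) * e * (2 * C1V * BVV + 6 * C3V * (1 + C2V) * (C2V + 2 * α₁ * e * C1V * BVV)))) * E := by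
  gcongr

/-! ## §2 ★★★ The `hGblk`(Π) family, ∃-packaged -/

set_option maxHeartbeats 400000 in
-- HEARTBEAT BUDGET (README rule, disclosed): seven `obtain`s + five `blockLetter_mono_rate` readers + D3's 20-binder instantiation in ONE decl — measured: fails at
-- 100 000 (`whnf`), passes at the 200 000 default; budgeted ×2 against the CI cliff.  §1 is budget-free.
/-- ★★★ **THE `hGblk`(Π) FAMILY: THE BLOCK-SUPPORTED DECAYED SUP ROW OF `G_π` (AND ITS `D*`-TWIN) FOR ALL MEMBERS, L-ONLY CONSTANTS.**  For positive L-only weights `c₀ cB` and a coupling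
window `0 < a₀ ≤ a₁` there are `αP CP KP δP : ℕ → ℝ` with `0 < αP L`, `10¹²L³αP L ≤ 1`, `10¹⁰L⁶αP L ≤ 1`, `13·10¹⁴L³αP L ≤ 1`, `0 ≤ CP L`, `0 ≤ KP L`, `0 < δP L`, and: for every `L > 1`, member
`i : Idx L`, background `U₀` with `RegPr ρ U₀`, `ρ ≤ αP L`, under `Lift`, with the T1 no-wrap ROOM, and coupling `a₀(c₀ L∕cB L)ℓ³ ≤ a ≤ a₁(c₀ L∕cB L)ℓ³`: D3's two conclusions (and, third, D4's cone letter
`G_π − G₀` with constant `α′·KP L` for every radius `0 ≤ α′ ≤ αP L` with `RegPr α′ U₀`) at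
`G_π = GT … a (DeltaPiSlotP … a) U₀` with constant `CP L` and rate `δP L` (print's (3.46)∕(3.49) `O(1)` decayed block rows of `G_π`, uniform in `K`).
[cite: Balaban1985BackgroundPropagators, Thm 3.3 (3.46)–(3.49) pp.398–399, (3.118)–(3.122) pp.419–420, Thm 3.12 p.423; Balaban1985Variational, Thm 1 p.279] -/
theorem hGblk_pi_family_exists (c₀ cB : ℕ → ℝ) [hc₀ : ∀ L : ℕ, Fact (0 < c₀ L)] [hcB : ∀ L : ℕ, Fact (0 < cB L)] {a₀ a₁ : ℝ} (ha₀ : 0 < a₀) (ha₀₁ : a₀ ≤ a₁) :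
    ∃ (αP CP KP δP : ℕ → ℝ),
      (∀ L : ℕ, 1 < L → 0 < αP L) ∧ (∀ L : ℕ, 1 < L → 10 ^ 12 * (L : ℝ) ^ 3 * αP L ≤ 1) ∧ (∀ L : ℕ, 1 < L → 10 ^ 10 * (L : ℝ) ^ 6 * αP L ≤ 1) ∧
      (∀ L : ℕ, 1 < L → 13 * 10 ^ 14 * (L : ℝ) ^ 3 * αP L ≤ 1) ∧ (∀ L : ℕ, 1 < L → 0 ≤ CP L) ∧ (∀ L : ℕ, 1 < L → 0 ≤ KP L) ∧ (∀ L : ℕ, 1 < L → 0 < δP L) ∧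
    ∀ (L : ℕ), 1 < L → ∀ (i : T3Thm1Carrier.Idx L) (U₀ : GaugeField (i.1.1.P i.1.2.2) 0 (Matrix.specialUnitaryGroup (Fin 2) ℂ)), ∀ ρ : ℝ, RegPr i.1.1 i.1.2.1 i.1.2.2 ρ U₀ → ρ ≤ αP L →
        (∀ cf : Site (i.1.1.P i.1.2.2) (i.1.2.2 - i.1.2.1) → Matrix (Fin 2) (Fin 2) ℂ,
        (∀ e' : PBond (i.1.1.P i.1.2.2) (i.1.2.2 - i.1.2.1), cf e'.src = ((emlIterU (i.1.2.2 - i.1.2.1) (bgUnits i.1.1 i.1.2.2 U₀) e' : (Matrix (Fin 2) (Fin 2) ℂ)ˣ) : Matrix (Fin 2) (Fin 2) ℂ) * cf e'.tgt *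
        (((emlIterU (i.1.2.2 - i.1.2.1) (bgUnits i.1.1 i.1.2.2 U₀) e')⁻¹ : (Matrix (Fin 2) (Fin 2) ℂ)ˣ) : Matrix (Fin 2) (Fin 2) ℂ)) →
        ∃ l₀ : Site (i.1.1.P i.1.2.2) 0 → Matrix (Fin 2) (Fin 2) ℂ,
        (∀ b' : PBond (i.1.1.P i.1.2.2) 0, l₀ b'.src = ((bgUnits i.1.1 i.1.2.2 U₀ b' : (Matrix (Fin 2) (Fin 2) ℂ)ˣ) : Matrix (Fin 2) (Fin 2) ℂ) * l₀ b'.tgt * (((bgUnits i.1.1 i.1.2.2 U₀ b')⁻¹ : (Matrix (Fin 2) (Fin 2) ℂ)ˣ) : Matrix (Fin 2) (Fin 2) ℂ)) ∧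
        ∀ y : Site (i.1.1.P i.1.2.2) (i.1.2.2 - i.1.2.1), l₀ (embIter (i.1.2.2 - i.1.2.1) y) = cf y) →
        2 * (12 * i.1.1.L ^ (i.1.2.2 - i.1.2.1) + 5) ≤ (i.1.1.P i.1.2.2).sitesPerDir 0 →
      ∀ a : ℝ, a₀ * (c₀ L / cB L) * ((i.1.1.L : ℝ) ^ (i.1.2.2 - i.1.2.1)) ^ 3 ≤ a → a ≤ a₁ * (c₀ L / cB L) * ((i.1.1.L : ℝ) ^ (i.1.2.2 - i.1.2.1)) ^ 3 →
      (∀ (X : PBond (i.1.1.P i.1.2.2) 0 → Matrix (Fin 2) (Fin 2) ℂ) (z : Site (i.1.1.P i.1.2.2) (i.1.2.2 - i.1.2.1)),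
        (∀ b, X b ≠ 0 → iterBlockOf (i.1.2.2 - i.1.2.1) b.src = z) → ∀ s : ℝ, 0 ≤ s → (∀ b, ‖X b‖ ≤ s) →
          ∀ bd : PBond (i.1.1.P i.1.2.2) 0,
            ‖(toL2 i.1.1 i.1.2.2 (c₀ L)).symm (GT i.1.1 i.1.2.1 i.1.2.2 i.2.2.le (c₀ L) (cB L) a (DeltaPiSlotP i.1.1 i.1.2.1 i.1.2.2 i.2.2.le (c₀ L) (cB L) a) U₀
                (toL2 i.1.1 i.1.2.2 (c₀ L) X)) bd‖
              ≤ s * CP L * Real.exp (-(δP L * (Site.tdist (P := i.1.1.P i.1.2.2) (iterBlockOf (i.1.2.2 - i.1.2.1) bd.src) z : ℝ)))) ∧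
      (∀ (X : PBond (i.1.1.P i.1.2.2) 0 → Matrix (Fin 2) (Fin 2) ℂ) (z : Site (i.1.1.P i.1.2.2) (i.1.2.2 - i.1.2.1)),
        (∀ b, X b ≠ 0 → iterBlockOf (i.1.2.2 - i.1.2.1) b.src = z) → ∀ s : ℝ, 0 ≤ s → (∀ b, ‖X b‖ ≤ s) →
          ∀ x : Site (i.1.1.P i.1.2.2) 0,
            ‖(toL2S i.1.1 i.1.2.2 (c₀ L)).symm (DstarL2 i.1.1 i.1.2.1 i.1.2.2 (c₀ L) U₀ (GT i.1.1 i.1.2.1 i.1.2.2 i.2.2.le (c₀ L) (cB L) a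
                (DeltaPiSlotP i.1.1 i.1.2.1 i.1.2.2 i.2.2.le (c₀ L) (cB L) a) U₀ (toL2 i.1.1 i.1.2.2 (c₀ L) X))) x‖
              ≤ s * CP L * Real.exp (-(δP L * (Site.tdist (P := i.1.1.P i.1.2.2) (iterBlockOf (i.1.2.2 - i.1.2.1) x) z : ℝ)))) ∧
      (∀ α' : ℝ, 0 ≤ α' → α' ≤ αP L → RegPr i.1.1 i.1.2.1 i.1.2.2 α' U₀ →
        ∀ (X : PBond (i.1.1.P i.1.2.2) 0 → Matrix (Fin 2) (Fin 2) ℂ) (z : Site (i.1.1.P i.1.2.2) (i.1.2.2 - i.1.2.1)),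
        (∀ b, X b ≠ 0 → iterBlockOf (i.1.2.2 - i.1.2.1) b.src = z) → ∀ s : ℝ, 0 ≤ s → (∀ b, ‖X b‖ ≤ s) →
          ∀ bd : PBond (i.1.1.P i.1.2.2) 0,
            ‖(toL2 i.1.1 i.1.2.2 (c₀ L)).symm ((GT i.1.1 i.1.2.1 i.1.2.2 i.2.2.le (c₀ L) (cB L) a (DeltaPiSlotP i.1.1 i.1.2.1 i.1.2.2 i.2.2.le (c₀ L) (cB L) a) U₀
                - GT i.1.1 i.1.2.1 i.1.2.2 i.2.2.le (c₀ L) (cB L) a (DeltaEtaSlot i.1.1 i.1.2.1 i.1.2.2 (c₀ L)) U₀) (toL2 i.1.1 i.1.2.2 (c₀ L) X)) bd‖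
              ≤ s * (α' * KP L) * Real.exp (-(δP L * (Site.tdist (P := i.1.1.P i.1.2.2) (iterBlockOf (i.1.2.2 - i.1.2.1) bd.src) z : ℝ)))) := by
  -- the seven landed packages
  obtain ⟨αG, BV, δG, hαG0, hWG1, hWG2, hWG3, hBV0, hδG0, hGb⟩ := blockSup_GT_DeltaEtaSlot_family c₀ cB ha₀ ha₀₁
  obtain ⟨αD, BD, δD, hαD0, hWD1, hWD2, hWD3, hBD0, hδD0, hDb⟩ := divergence_GT_DeltaEtaSlot_family c₀ cB ha₀ ha₀₁
  obtain ⟨αC, C₁, δC, hαC, hC₁0, hδC0, hC13⟩ := hc1b_hc3b_family (am := 1) one_pos c₀ cB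
  obtain ⟨αC2, C₂, δC2, hαC2, hC₂0, hδC20, hC2⟩ := hc2b_family (am := 1) one_pos c₀ cB
  obtain ⟨αη, γη, hαη0, hWη1, hWη3, hγη, hcoη⟩ := hco_DeltaEtaSlot_exists c₀ cB ha₀
  obtain ⟨απ, γπ, hαπ0, hWπ1, hWπ3, hγπ, hcoπ⟩ := hco_DeltaPiSlotP_exists c₀ cB ha₀
  -- the L-only choices
  set δ₁ : ℕ → ℝ := fun L => min (min (δG L) (δD L)) (min (δC L) (δC2 L)) with hδ₁
  set ν : ℕ → ℝ := fun L => δ₁ L / 2 with hν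
  set αP : ℕ → ℝ := fun L => min (min (min (αG L) (αD L)) (min (αC L) (αC2 L))) (min (min (αη L) (απ L))
      (1 / (2 * (2 * (1 + Real.exp (4 * ν L)) * ((C₁ L * (2 * (1 + 1 / ν L)) ^ 3) * (BV L * (2 * (1 + 1 / ν L)) ^ 3 + BD L * (2 * (1 + 1 / ν L)) ^ 3)
      + 3 * (C₁ L * (2 * (1 + 1 / ν L)) ^ 3) * (1 + C₂ L * (2 * (1 + 1 / ν L)) ^ 3) * ((1 + C₂ L * (2 * (1 + 1 / ν L)) ^ 3) + 2 * (1 + Real.exp (4 * ν L)) * (C₁ L * (2 * (1 + 1 / ν L)) ^ 3) * (BV L * (2 * (1 + 1 / ν L)) ^ 3 + BD L * (2 * (1 + 1 / ν L)) ^ 3)))) + 2))) with hαP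
  have hδ₁0 : ∀ L, 1 < L → 0 < δ₁ L := fun L hL => by
    have := hδG0 L hL; have := hδD0 L hL; have := hδC0 L; have := hδC20 L
    simp only [hδ₁]; exact lt_min (lt_min (by assumption) (by assumption)) (lt_min (by assumption) (by assumption))
  have hν0 : ∀ L, 1 < L → 0 < ν L := fun L hL => by have := hδ₁0 L hL; simp only [hν]; positivity
  have hW0 : ∀ L, 1 < L → 0 ≤ (2 * (1 + Real.exp (4 * ν L)) * ((C₁ L * (2 * (1 + 1 / ν L)) ^ 3) * (BV L * (2 * (1 + 1 / ν L)) ^ 3 + BD L * (2 * (1 + 1 / ν L)) ^ 3)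
      + 3 * (C₁ L * (2 * (1 + 1 / ν L)) ^ 3) * (1 + C₂ L * (2 * (1 + 1 / ν L)) ^ 3) * ((1 + C₂ L * (2 * (1 + 1 / ν L)) ^ 3) + 2 * (1 + Real.exp (4 * ν L)) * (C₁ L * (2 * (1 + 1 / ν L)) ^ 3) * (BV L * (2 * (1 + 1 / ν L)) ^ 3 + BD L * (2 * (1 + 1 / ν L)) ^ 3)))) := fun L hL => by
    have := hν0 L hL; have := hC₁0 L; have := hC₂0 L hL; have := hBV0 L hL; have := hBD0 L hL
    positivity
  have hαP0 : ∀ L, 1 < L → 0 < αP L := fun L hL => by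
    have := hαG0 L hL; have := hαD0 L hL; have := (hαC L hL).1; have := (hαC2 L hL).1; have := hαη0 L hL; have := hαπ0 L hL; have := hW0 L hL
    simp only [hαP]
    exact lt_min (lt_min (lt_min (by assumption) (by assumption)) (lt_min (by assumption) (by assumption)))
      (lt_min (lt_min (by assumption) (by assumption)) (by positivity))
  -- cap projections
  have hPG : ∀ L, αP L ≤ αG L := fun L => by simp only [hαP]; exact (min_le_left _ _).trans ((min_le_left _ _).trans (min_le_left _ _))
  have hPD : ∀ L, αP L ≤ αD L := fun L => by simp only [hαP]; exact (min_le_left _ _).trans ((min_le_left _ _).trans (min_le_right _ _))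
  have hPC : ∀ L, αP L ≤ αC L := fun L => by simp only [hαP]; exact (min_le_left _ _).trans ((min_le_right _ _).trans (min_le_left _ _))
  have hPC2 : ∀ L, αP L ≤ αC2 L := fun L => by simp only [hαP]; exact (min_le_left _ _).trans ((min_le_right _ _).trans (min_le_right _ _))
  have hPη : ∀ L, αP L ≤ αη L := fun L => by simp only [hαP]; exact (min_le_right _ _).trans ((min_le_left _ _).trans (min_le_left _ _))
  have hPπ : ∀ L, αP L ≤ απ L := fun L => by simp only [hαP]; exact (min_le_right _ _).trans ((min_le_left _ _).trans (min_le_right _ _))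
  have hPW : ∀ L, αP L ≤ 1 / (2 * (2 * (1 + Real.exp (4 * ν L)) * ((C₁ L * (2 * (1 + 1 / ν L)) ^ 3) * (BV L * (2 * (1 + 1 / ν L)) ^ 3 + BD L * (2 * (1 + 1 / ν L)) ^ 3)
      + 3 * (C₁ L * (2 * (1 + 1 / ν L)) ^ 3) * (1 + C₂ L * (2 * (1 + 1 / ν L)) ^ 3) * ((1 + C₂ L * (2 * (1 + 1 / ν L)) ^ 3) + 2 * (1 + Real.exp (4 * ν L)) * (C₁ L * (2 * (1 + 1 / ν L)) ^ 3) * (BV L * (2 * (1 + 1 / ν L)) ^ 3 + BD L * (2 * (1 + 1 / ν L)) ^ 3)))) + 2) := fun L => by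
    simp only [hαP]; exact (min_le_right _ _).trans (min_le_right _ _)
  -- rate projections
  have h₁G : ∀ L, δ₁ L ≤ δG L := fun L => by simp only [hδ₁]; exact (min_le_left _ _).trans (min_le_left _ _)
  have h₁D : ∀ L, δ₁ L ≤ δD L := fun L => by simp only [hδ₁]; exact (min_le_left _ _).trans (min_le_right _ _)
  have h₁C : ∀ L, δ₁ L ≤ δC L := fun L => by simp only [hδ₁]; exact (min_le_right _ _).trans (min_le_left _ _)
  have h₁C2 : ∀ L, δ₁ L ≤ δC2 L := fun L => by simp only [hδ₁]; exact (min_le_right _ _).trans (min_le_right _ _)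
  refine ⟨αP, fun L => 2 * (BV L * (2 * (1 + 1 / ν L)) ^ 3 + BD L * (2 * (1 + 1 / ν L)) ^ 3),
    fun L => 2 * ((BV L * (2 * (1 + 1 / ν L)) ^ 3) + (BD L * (2 * (1 + 1 / ν L)) ^ 3)) * (1 + Real.exp (4 * ν L)) * (2 * (C₁ L * (2 * (1 + 1 / ν L)) ^ 3) * (BV L * (2 * (1 + 1 / ν L)) ^ 3) + 6 * (C₁ L * (2 * (1 + 1 / ν L)) ^ 3) * (1 + (C₂ L * (2 * (1 + 1 / ν L)) ^ 3)) * ((C₂ L * (2 * (1 + 1 / ν L)) ^ 3) + 2 * αP L * (1 + Real.exp (4 * ν L)) * (C₁ L * (2 * (1 + 1 / ν L)) ^ 3) * (BV L * (2 * (1 + 1 / ν L)) ^ 3))),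
    ν, hαP0, fun L hL => ?_, fun L hL => ?_, fun L hL => ?_, fun L hL => ?_, fun L hL => ?_, hν0, ?_⟩
  · exact (mul_le_mul_of_nonneg_left (hPG L) (by positivity)).trans (hWG1 L hL)
  · exact (mul_le_mul_of_nonneg_left (hPG L) (by positivity)).trans (hWG2 L hL)
  · exact (mul_le_mul_of_nonneg_left (hPG L) (by positivity)).trans (hWG3 L hL)
  · have := hν0 L hL; have := hBV0 L hL; have := hBD0 L hL
    positivity
  · have := hν0 L hL; have := hBV0 L hL; have := hBD0 L hL; have := hC₁0 L; have := hC₂0 L hL; have := hαP0 L hL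
    positivity
  -- the member
  intro L hL i U₀ ρ hreg hρ hlift hroom a ha₀a ha₁a
  have hc₀L : 0 < c₀ L := (hc₀ L).out
  have hcBL : 0 < cB L := (hcB L).out
  have hL0 : (0 : ℝ) < L := by exact_mod_cast lt_trans zero_lt_one hL
  have hLL : (L : ℝ) = (i.1.1.L : ℝ) := by rw [i.2.1]
  have ha : 0 ≤ a := le_trans (by positivity) ha₀a
  have hνL := hν0 L hL
  have hαL := hαP0 L hL
  have hregP : RegPr i.1.1 i.1.2.1 i.1.2.2 (αP L) U₀ := regPr_mono i.1.1 hρ hreg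
  -- windows at this member (`F.L = L`)
  have hW13ρ : 13 * 10 ^ 14 * (i.1.1.L : ℝ) ^ 3 * ρ ≤ 1 := by
    rw [← hLL]
    exact (mul_le_mul_of_nonneg_left (hρ.trans (hPη L)) (by positivity)).trans (hWη3 L hL)
  -- the two positivity classes from (γ)
  have hcoη' := hcoη L hL i U₀ ρ hreg (hρ.trans (hPη L)) hlift a ha₀a
  have hcoπ' := hcoπ L hL i U₀ ρ hreg (hρ.trans (hPπ L)) hlift a ha₀a
  have hp₀ : PosOnto i.1.1 i.1.2.1 i.1.2.2 i.2.2.le (c₀ L) (cB L) a (DeltaEtaSlot i.1.1 i.1.2.1 i.1.2.2 (c₀ L)) U₀ :=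
    posOnto_of_coercive i.2.2.le (cB L) i.2.2 hreg hW13ρ (hγη L hL) _ hcoη'
  have hpπ : PosOnto i.1.1 i.1.2.1 i.1.2.2 i.2.2.le (c₀ L) (cB L) a (DeltaPiSlotP i.1.1 i.1.2.1 i.1.2.2 i.2.2.le (c₀ L) (cB L) a) U₀ :=
    posOnto_of_coercive i.2.2.le (cB L) i.2.2 hreg hW13ρ (hγπ L hL) _ hcoπ'
  -- the five block letters at the member, weakened to the common rate `δ₁ L`
  have hGb' := blockLetter_mono_rate (fun b : PBond (i.1.1.P i.1.2.2) 0 => iterBlockOf (i.1.2.2 - i.1.2.1) b.src)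
    (fun bd : PBond (i.1.1.P i.1.2.2) 0 => iterBlockOf (i.1.2.2 - i.1.2.1) bd.src)
    (fun X bd => (toL2 i.1.1 i.1.2.2 (c₀ L)).symm (GT i.1.1 i.1.2.1 i.1.2.2 i.2.2.le (c₀ L) (cB L) a (DeltaEtaSlot i.1.1 i.1.2.1 i.1.2.2 (c₀ L)) U₀
      (toL2 i.1.1 i.1.2.2 (c₀ L) X)) bd)
    (hBV0 L hL) (h₁G L) (hGb L hL i U₀ ρ hreg (hρ.trans (hPG L)) hlift a ha₀a ha₁a)
  have hDb' := blockLetter_mono_rate (fun b : PBond (i.1.1.P i.1.2.2) 0 => iterBlockOf (i.1.2.2 - i.1.2.1) b.src)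
    (fun x : Site (i.1.1.P i.1.2.2) 0 => iterBlockOf (i.1.2.2 - i.1.2.1) x)
    (fun X x => (toL2S i.1.1 i.1.2.2 (c₀ L)).symm (DstarL2 i.1.1 i.1.2.1 i.1.2.2 (c₀ L) U₀ (GT i.1.1 i.1.2.1 i.1.2.2 i.2.2.le (c₀ L) (cB L) a
      (DeltaEtaSlot i.1.1 i.1.2.1 i.1.2.2 (c₀ L)) U₀ (toL2 i.1.1 i.1.2.2 (c₀ L) X))) x)
    (hBD0 L hL) (h₁D L) (hDb L hL i U₀ ρ hreg (hρ.trans (hPD L)) hlift a ha₀a ha₁a hroom)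
  have hC13' := hC13 L hL i U₀ ρ hreg (hρ.trans (hPC L)) hlift a ha
  have hc1b' := blockLetter_mono_rate (fun y : Site (i.1.1.P i.1.2.2) 0 => iterBlockOf (i.1.2.2 - i.1.2.1) y)
    (fun y : Site (i.1.1.P i.1.2.2) 0 => iterBlockOf (i.1.2.2 - i.1.2.1) y)
    (fun v y => (toL2S i.1.1 i.1.2.2 (c₀ L)).symm (GprimeP i.1.1 i.1.2.1 i.1.2.2 i.2.2.le (c₀ L) (cB L) a U₀
      (RS i.1.1 i.1.2.1 i.1.2.2 i.2.2.le (c₀ L) (cB L) U₀ (toL2S i.1.1 i.1.2.2 (c₀ L) v))) y)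
    (hC₁0 L) (h₁C L) hC13'.1
  have hc3b' := blockLetter_mono_rate (fun y : Site (i.1.1.P i.1.2.2) 0 => iterBlockOf (i.1.2.2 - i.1.2.1) y)
    (fun y : Site (i.1.1.P i.1.2.2) 0 => iterBlockOf (i.1.2.2 - i.1.2.1) y)
    (fun v y => (toL2S i.1.1 i.1.2.2 (c₀ L)).symm (RS i.1.1 i.1.2.1 i.1.2.2 i.2.2.le (c₀ L) (cB L) U₀
      (GprimeP i.1.1 i.1.2.1 i.1.2.2 i.2.2.le (c₀ L) (cB L) a U₀ (toL2S i.1.1 i.1.2.2 (c₀ L) v))) y)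
    (hC₁0 L) (h₁C L) hC13'.2
  have hc2b' := blockLetter_mono_rate (fun y : Site (i.1.1.P i.1.2.2) 0 => iterBlockOf (i.1.2.2 - i.1.2.1) y)
    (fun b : PBond (i.1.1.P i.1.2.2) 0 => iterBlockOf (i.1.2.2 - i.1.2.1) b.src)
    (fun v b => (toL2 i.1.1 i.1.2.2 (c₀ L)).symm (DL2 i.1.1 i.1.2.1 i.1.2.2 (c₀ L) U₀ (GprimeP i.1.1 i.1.2.1 i.1.2.2 i.2.2.le (c₀ L) (cB L) a U₀
      (RS i.1.1 i.1.2.1 i.1.2.2 i.2.2.le (c₀ L) (cB L) U₀ (toL2S i.1.1 i.1.2.2 (c₀ L) v)))) b)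
    (hC₂0 L hL) (h₁C2 L) (hC2 L hL i U₀ ρ hreg (hρ.trans (hPC2 L)) hlift hroom a ha)
  -- the window at the cap `αP L`
  have hαP1 : αP L ≤ 1 := by
    have h1 := hWG1 L hL
    have hG1 : αG L ≤ 1 := by
      have hL1 : (1 : ℝ) ≤ 10 ^ 12 * (L : ℝ) ^ 3 := by
        have : (1 : ℝ) ≤ (L : ℝ) ^ 3 := one_le_pow₀ (by exact_mod_cast hL.le)
        nlinarith
      have hαG' := hαG0 L hL
      nlinarith
    exact (hPG L).trans hG1
  have hwin := hwin_of_le_inv (E := 2 * (1 + Real.exp (4 * ν L))) (A := C₁ L * (2 * (1 + 1 / ν L)) ^ 3) (B := BV L * (2 * (1 + 1 / ν L)) ^ 3 + BD L * (2 * (1 + 1 / ν L)) ^ 3) (C := C₁ L * (2 * (1 + 1 / ν L)) ^ 3)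
    (D := 1 + C₂ L * (2 * (1 + 1 / ν L)) ^ 3) (α := αP L) (by positivity) (by have := hC₁0 L; positivity) (by have := hBV0 L hL; have := hBD0 L hL; positivity)
    (by have := hC₁0 L; positivity) (by have := hC₂0 L hL; positivity) hαL.le hαP1 (hPW L)
  -- D3 at the member
  have hD3 := hGblk_pi_of_blockLetters (F := i.1.1) (h := i.2.2.le) (c₀ := c₀ L) (cB := cB L) (a := a) (δ := ν L) (δ₁ := δ₁ L) (ν := ν L)
    hνL.le hνL (by simp only [hν]; linarith) U₀ hregP ha hp₀ hpπ (hBV0 L hL) (hBD0 L hL) (hC₁0 L) (hC₂0 L hL) (hC₁0 L)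
    hGb' hDb' hc1b' hc2b' hc3b' hwin
  refine ⟨hD3.1, hD3.2, fun α' hα'0 hα'1 hreg' X z hXz s hs hX bd => ?_⟩
  -- the cone letter (D4) at the radius `α' ≤ αP L`, then monotonicity of its constant in the radius
  have hwin' := hwin_of_le_inv (E := 2 * (1 + Real.exp (4 * ν L))) (A := C₁ L * (2 * (1 + 1 / ν L)) ^ 3) (B := BV L * (2 * (1 + 1 / ν L)) ^ 3 + BD L * (2 * (1 + 1 / ν L)) ^ 3) (C := C₁ L * (2 * (1 + 1 / ν L)) ^ 3)
    (D := 1 + C₂ L * (2 * (1 + 1 / ν L)) ^ 3) (α := α') (by positivity) (by have := hC₁0 L; positivity) (by have := hBV0 L hL; have := hBD0 L hL; positivity)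
    (by have := hC₁0 L; positivity) (by have := hC₂0 L hL; positivity) hα'0 (hα'1.trans hαP1) (hα'1.trans (hPW L))
  have hD4 := hDelta_pi_of_blockLetters (F := i.1.1) (h := i.2.2.le) (c₀ := c₀ L) (cB := cB L) (a := a) (δ := ν L) (δ₁ := δ₁ L) (ν := ν L)
    hνL.le hνL (by simp only [hν]; linarith) U₀ hreg' ha hp₀ hpπ (hBV0 L hL) (hBD0 L hL) (hC₁0 L) (hC₂0 L hL) (hC₁0 L)
    hGb' hDb' hc1b' hc2b' hc3b' hwin' X z hXz s hs hX bd
  exact hD4.trans (cone_const_mono hs hα'0 hα'1 (by have := hBV0 L hL; positivity) (by have := hBD0 L hL; positivity)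
    (by have := hC₁0 L; positivity) (by have := hC₂0 L hL; positivity) (by have := hC₁0 L; positivity) (by positivity) (Real.exp_pos _).le)

end Summit.QuantumFields.YangMills.Theorems.Prop7GreenPiBlockFamilyPackage

end
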